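import Literature.AlgebraicGeometry.AbelianSchemes.AbelianSchemeOverMulNUnramified
import Literature.AlgebraicGeometry.FundamentalGroup.EtaleComplexPointsLiftUnique
import Literature.AlgebraicGeometry.FundamentalGroup.RiemannExistenceFullyFaithfulContinuous
import HarnessLib

/-!
# Continuous families of points of a complex abelian scheme with the same `[N]`-image coincide

Topic `AlgebraicGeometry/AbelianSchemes`; namespace `Literature.AlgebraicGeometry.AbelianSchemes.AbelianSchemeOver`;
THEOREMS ONLY (no definition, no named fact, no instance).  Let `S` be a scheme separated over `ℂ`
(`S : SchemeOver ℂ`, `[IsSeparated S.hom]`), `A : AbelianSchemeOver S.left` an abelian scheme over it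
([MumfordFogartyKirwan1994] Def. 6.1) and `N ≠ 0`.  Regard the total space and «multiplication by `N`» as objects over
`ℂ`: `𝒳 := (Over.map S.hom).obj A.X`, `[N] := (Over.map S.hom).map ((𝟙 A.X) ^ N)` (Mathlib `Over.map`; the
underlying scheme morphism is literally `((𝟙 A.X) ^ N).left`).  Then `[N](ℂ) : 𝒳(ℂ) → 𝒳(ℂ)` has UNIQUE CONTINUOUS
LIFTS on connected spaces: two continuous maps `g₁ g₂ : W → 𝒳(ℂ)` from a preconnected space with
`[N](ℂ) ∘ g₁ = [N](ℂ) ∘ g₂` which agree at one point are equal — in particular two continuous families of `N`-TORSION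
points over the same base points which agree at one parameter agree everywhere (the rigidity of torsion sections behind
«level structures are locally constant», [Milne1986AbelianVarieties] §20 (proof of Thm. 20.3) / [GortzWedhorn2023] Prop. 27.187:
`X[N] → S` is finite étale for `N` invertible on `S`).

Proof = the two tree inputs glued: `[N]` is formally unramified and locally of finite type on an abelian scheme over a
base of characteristic `0` (★ `AbelianSchemeOver.formallyUnramified_pow_id_left_of_charZero`,
`locallyOfFiniteType_pow_id_left`, [BLRNeronModels1990] §7.3 Prop. 2), `𝒳 → Spec ℂ` is separated (proper over a
separated base), and continuous lifts through an unramified morphism of separated `ℂ`-schemes are unique on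
preconnected spaces: `[N](ℂ)` is locally injective (★ `FundamentalGroup.isLocallyInjective_map_of_formallyUnramified`,
[SGA1] XII Prop. 3.1 (ii)) and separated (★ `FundamentalGroup.isSeparatedMap_map`), so Mathlib's
`IsSeparatedMap.eq_of_comp_eq` ([Hatcher2002] Prop. 1.34) applies — the pattern of ★
`FundamentalGroup.eq_of_comp_map_eq_of_etale`.

* `isSeparated_map_obj_hom` — `𝒳 = (Over.map S.hom).obj A.X` is separated over `ℂ`;
* `formallyUnramified_map_pow_id_left`, `locallyOfFiniteType_map_pow_id_left` — `[N]` over `ℂ` is unramified;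
* **`complexPoints_eq_of_pow_id_comp_eq`**, `complexPoints_eqOn_of_pow_id_comp_eqOn` — unique continuous lifting
  through `[N](ℂ)` on a preconnected space / set;
* **`complexPoints_eq_of_torsion_of_eq`**, `complexPoints_eqOn_of_torsion_of_eq` — two continuous families of
  `N`-torsion points over the same base points agreeing at one parameter agree on a preconnected space / set.

## References
* [BLRNeronModels1990] S. Bosch, W. Lütkebohmert, M. Raynaud, *Néron Models* (1990), §7.3 Prop. 2.
* [GortzWedhorn2023] U. Görtz, T. Wedhorn, *Algebraic Geometry II* (2023), Prop. 27.187.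
* [SGA1] A. Grothendieck, *Revêtements étales et groupe fondamental* (LNM 224), Exp. XII Prop. 3.1 (ii).
* [Hatcher2002] A. Hatcher, *Algebraic Topology* (2002), §1.3 Prop. 1.34 (p. 62).
-/

set_option autoImplicit false

universe v

open CategoryTheory AlgebraicGeometry MonoidalCategory
open scoped MonObj CategoryTheory.Obj

noncomputable section

namespace Literature.AlgebraicGeometry.AbelianSchemes

namespace AbelianSchemeOver

open Literature.AlgebraicGeometry.Motives Literature.AlgebraicGeometry.Motives.AlgPoints
open Literature.AlgebraicGeometry.FundamentalGroup

variable {S : Motives.SchemeOver ℂ} (A : AbelianSchemeOver S.left)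

/-- The total space `𝒳 = (Over.map S.hom).obj A.X` of an abelian scheme over a base `S` separated over `ℂ` is separated
over `ℂ`: `𝒳 → S` is proper, in particular separated, and separated morphisms compose.
[cite: GortzWedhorn2020, Prop. 9.13 (separated morphisms are stable under composition); Def. 12.55 (proper ⇒ separated)] -/
theorem isSeparated_map_obj_hom [IsSeparated S.hom] : IsSeparated ((Over.map S.hom).obj A.X).hom := by
  haveI := A.isProper
  have h : IsSeparated (A.X.hom ≫ S.hom) :=
    MorphismProperty.comp_mem @IsSeparated A.X.hom S.hom (inferInstanceAs (IsSeparated A.X.hom)) ‹IsSeparated S.hom›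
  rw [Over.map_obj_hom]
  exact h

/-- `[N] = (Over.map S.hom).map ((𝟙 A.X) ^ N)`, read over `ℂ`, is formally unramified for `N ≠ 0` (its underlying scheme
morphism is `((𝟙 A.X) ^ N).left`, ★ `formallyUnramified_pow_id_left_of_charZero` at `f := S.hom`).
[cite: BLRNeronModels1990, §7.3 Prop. 2] [cite: GortzWedhorn2023, Prop. 27.187] -/
theorem formallyUnramified_map_pow_id_left {N : ℕ} (hN : N ≠ 0) :
    FormallyUnramified ((Over.map S.hom).map ((𝟙 A.X : A.X ⟶ A.X) ^ N)).left :=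
  A.formallyUnramified_pow_id_left_of_charZero S.hom hN

/-- `[N]`, read over `ℂ`, is locally of finite type (★ `locallyOfFiniteType_pow_id_left`).
[cite: GortzWedhorn2020, Prop. 10.7 (cancellation for morphisms locally of finite type)] -/
theorem locallyOfFiniteType_map_pow_id_left (N : ℕ) :
    LocallyOfFiniteType ((Over.map S.hom).map ((𝟙 A.X : A.X ⟶ A.X) ^ N)).left :=
  A.locallyOfFiniteType_pow_id_left N

variable {W : Type v} [TopologicalSpace W] {s : Set W}
  {g₁ g₂ : W → Motives.ComplexPoints ((Over.map S.hom).obj A.X)}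

/-- **Unique continuous lifting through `[N](ℂ)` on a connected space**: for an abelian scheme `A` over a base `S`
separated over `ℂ` and `N ≠ 0`, two continuous maps `g₁ g₂ : W → 𝒳(ℂ)` from a preconnected space with
`[N](ℂ) ∘ g₁ = [N](ℂ) ∘ g₂` which agree at one point are equal (`[N]` is unramified, so `[N](ℂ)` is locally
injective, ★ `FundamentalGroup.isLocallyInjective_map_of_formallyUnramified`, and separated, ★ `isSeparatedMap_map`;
Mathlib `IsSeparatedMap.eq_of_comp_eq`). [cite: SGA1, Exp. XII Prop. 3.1 (ii)]
[cite: Hatcher2002, §1.3 Prop. 1.34 (p. 62)] [cite: GortzWedhorn2023, Prop. 27.187] -/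
theorem complexPoints_eq_of_pow_id_comp_eq [IsSeparated S.hom] [PreconnectedSpace W] {N : ℕ} (hN : N ≠ 0)
    (h₁ : Continuous g₁) (h₂ : Continuous g₂)
    (he : (AlgPoints.map ((Over.map S.hom).map ((𝟙 A.X : A.X ⟶ A.X) ^ N)) :
        Motives.ComplexPoints ((Over.map S.hom).obj A.X) → Motives.ComplexPoints ((Over.map S.hom).obj A.X)) ∘ g₁ =
      AlgPoints.map ((Over.map S.hom).map ((𝟙 A.X : A.X ⟶ A.X) ^ N)) ∘ g₂)
    (w : W) (hw : g₁ w = g₂ w) : g₁ = g₂ := by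
  haveI := A.isSeparated_map_obj_hom
  haveI := A.formallyUnramified_map_pow_id_left hN
  haveI := A.locallyOfFiniteType_map_pow_id_left N
  exact (isSeparatedMap_map _).eq_of_comp_eq (isLocallyInjective_map_of_formallyUnramified
    (X := (Over.map S.hom).obj A.X) ((Over.map S.hom).map ((𝟙 A.X : A.X ⟶ A.X) ^ N))) h₁ h₂ he w hw

/-- **Unique continuous lifting through `[N](ℂ)` on a preconnected set.** [cite: SGA1, Exp. XII Prop. 3.1 (ii)]
[cite: Hatcher2002, §1.3 Prop. 1.34 (p. 62)] [cite: GortzWedhorn2023, Prop. 27.187] -/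
theorem complexPoints_eqOn_of_pow_id_comp_eqOn [IsSeparated S.hom] {N : ℕ} (hN : N ≠ 0) (hs : IsPreconnected s)
    (h₁ : ContinuousOn g₁ s) (h₂ : ContinuousOn g₂ s)
    (he : s.EqOn ((AlgPoints.map ((Over.map S.hom).map ((𝟙 A.X : A.X ⟶ A.X) ^ N)) :
        Motives.ComplexPoints ((Over.map S.hom).obj A.X) → Motives.ComplexPoints ((Over.map S.hom).obj A.X)) ∘ g₁)
      (AlgPoints.map ((Over.map S.hom).map ((𝟙 A.X : A.X ⟶ A.X) ^ N)) ∘ g₂))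
    {w : W} (hws : w ∈ s) (hw : g₁ w = g₂ w) : s.EqOn g₁ g₂ := by
  haveI := A.isSeparated_map_obj_hom
  haveI := A.formallyUnramified_map_pow_id_left hN
  haveI := A.locallyOfFiniteType_map_pow_id_left N
  exact (isSeparatedMap_map _).eqOn_of_comp_eqOn (isLocallyInjective_map_of_formallyUnramified
    (X := (Over.map S.hom).obj A.X) ((Over.map S.hom).map ((𝟙 A.X : A.X ⟶ A.X) ^ N))) hs h₁ h₂ he hws hw

/-- **Two continuous families of `N`-torsion points over the same base points which agree at one parameter agree on a
connected space.**  «`N`-torsion over the base points `b`» is spelt `[N](ℂ) ∘ g = η(ℂ) ∘ b` with `η = η[A.X]` the zero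
section (read over `ℂ` by `Over.map S.hom`) and `b : W → (𝟙_ (Over S.left))(ℂ)` ANY family of base points (no continuity
needed): then `[N](ℂ) ∘ g₁ = [N](ℂ) ∘ g₂` and `complexPoints_eq_of_pow_id_comp_eq` applies.
[cite: GortzWedhorn2023, Prop. 27.187] [cite: SGA1, Exp. XII Prop. 3.1 (ii)] [cite: Hatcher2002, §1.3 Prop. 1.34 (p. 62)] -/
theorem complexPoints_eq_of_torsion_of_eq [IsSeparated S.hom] [PreconnectedSpace W] {N : ℕ} (hN : N ≠ 0)
    (h₁ : Continuous g₁) (h₂ : Continuous g₂) {b : W → Motives.ComplexPoints ((Over.map S.hom).obj (𝟙_ (Over S.left)))}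
    (ht₁ : (AlgPoints.map ((Over.map S.hom).map ((𝟙 A.X : A.X ⟶ A.X) ^ N)) :
        Motives.ComplexPoints ((Over.map S.hom).obj A.X) → Motives.ComplexPoints ((Over.map S.hom).obj A.X)) ∘ g₁ =
      AlgPoints.map ((Over.map S.hom).map (η[A.X] : 𝟙_ (Over S.left) ⟶ A.X)) ∘ b)
    (ht₂ : (AlgPoints.map ((Over.map S.hom).map ((𝟙 A.X : A.X ⟶ A.X) ^ N)) :
        Motives.ComplexPoints ((Over.map S.hom).obj A.X) → Motives.ComplexPoints ((Over.map S.hom).obj A.X)) ∘ g₂ =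
      AlgPoints.map ((Over.map S.hom).map (η[A.X] : 𝟙_ (Over S.left) ⟶ A.X)) ∘ b)
    (w : W) (hw : g₁ w = g₂ w) : g₁ = g₂ :=
  A.complexPoints_eq_of_pow_id_comp_eq hN h₁ h₂ (ht₁.trans ht₂.symm) w hw

/-- **… and on a preconnected set** (torsion over the same base points on `s`, agreement at one point of `s`).
[cite: GortzWedhorn2023, Prop. 27.187] [cite: SGA1, Exp. XII Prop. 3.1 (ii)] [cite: Hatcher2002, §1.3 Prop. 1.34 (p. 62)] -/
theorem complexPoints_eqOn_of_torsion_of_eq [IsSeparated S.hom] {N : ℕ} (hN : N ≠ 0) (hs : IsPreconnected s)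
    (h₁ : ContinuousOn g₁ s) (h₂ : ContinuousOn g₂ s)
    {b : W → Motives.ComplexPoints ((Over.map S.hom).obj (𝟙_ (Over S.left)))}
    (ht₁ : s.EqOn ((AlgPoints.map ((Over.map S.hom).map ((𝟙 A.X : A.X ⟶ A.X) ^ N)) :
        Motives.ComplexPoints ((Over.map S.hom).obj A.X) → Motives.ComplexPoints ((Over.map S.hom).obj A.X)) ∘ g₁)
      (AlgPoints.map ((Over.map S.hom).map (η[A.X] : 𝟙_ (Over S.left) ⟶ A.X)) ∘ b))
    (ht₂ : s.EqOn ((AlgPoints.map ((Over.map S.hom).map ((𝟙 A.X : A.X ⟶ A.X) ^ N)) :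
        Motives.ComplexPoints ((Over.map S.hom).obj A.X) → Motives.ComplexPoints ((Over.map S.hom).obj A.X)) ∘ g₂)
      (AlgPoints.map ((Over.map S.hom).map (η[A.X] : 𝟙_ (Over S.left) ⟶ A.X)) ∘ b))
    {w : W} (hws : w ∈ s) (hw : g₁ w = g₂ w) : s.EqOn g₁ g₂ :=
  A.complexPoints_eqOn_of_pow_id_comp_eqOn hN hs h₁ h₂ (ht₁.trans ht₂.symm) hws hw

end AbelianSchemeOver

end Literature.AlgebraicGeometry.AbelianSchemes

end
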